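import Summits.CriticalPhenomena.PercolationContinuityZ3.Theorems.PercNearOneGluingNoHeavyLowerTailHullPortTANSetMarkerDominance
import Summits.CriticalPhenomena.PercolationContinuityZ3.Theorems.PercNearOneGluingNoHeavyLowerTailKnQuestion9TwoRelays
import HarnessLib

/-!
# KN Question 8/9 at three relays — the pocket covariance comparison PCOV HOLDS for the Question-9 pocket `C_o = {o}`

Support file (`--supports stmt-CriticalPhenomena-4575`, closed), prover `prim-cplus-coupling` (gen 21).  No definitions, no named
facts, no sorries; standard axioms.  Memo `prim-cplus-coupling/A5-COUPLING-gen21.md` §0(8).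

prim-lf-2's pocket-designated dual certificate for Kozma–Nitzan's Question 8 / MC-D at `|A| = 3` (memo POCKET-CERT-gen16 §3, tree
`PocketCert.block41_three_of_pocketCert`, `PocketCert.p1star_pocket_of_pieces`) has two open one-cluster inputs per strong relay; the
covariance one is the POCKET COVARIANCE COMPARISON (P1**-D) = PCOV: with owner `x`, marker `y`, weak relay `z`, observer `o`, pocket event
`Dp`, `D = {x↮z}`, `N = Dp ∩ D`, `N1 = N ∩ {y ∈ C_x}`, `N0 = N ∖ N1`, `O = {o ∈ C_x} ∩ D`, `E2 = {y↮x} ∩ {y↮z}`,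
`c = μ(Dp ∩ E2)`, `b = μ({o ∈ C_y} ∩ E2)`, `n, n₁, n₀, β` the masses of `N, N1, N0, O`:
  **PCOV:  `c·[n·μ(O ∩ U) − β·μ(N ∩ U)] − b·[n₀·μ(N1 ∩ U) − n₁·μ(N0 ∩ U)] ≥ 0`  for every increasing event `U = {C_x ∈ 𝒰}`.**
THIS FILE proves PCOV for the QUESTION-9 POCKET `Dp = {C_o = {o}}` (no open pair at the observer; tree `starEvent o ∅`):
`PocketCert.pcov_questionNine`.  PROOF (memo §0(8)): decompose the observer-attached masses `μ(O ∩ U)`, `β`, `b` over the stars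
`σ_B` of `o` (`KNPreFKG.real_eq_sum_inter_starEvent`; under `σ_B` a path through `o` enters and leaves through `B`,
`KNPreFKG.walk_decomp`; `σ_B` is independent of the pairs off `o`, `KNGoodAux.real_starEvent_inter_of_determinedBy`): with `H = G ∖ o`
(`restrW {o}ᶜ w`), `β = Σ_B μ(σ_B)·μ_H(x↔B, z↮B)`, `b = Σ_B μ(σ_B)·μ_H(y↔B, x↮B, z↮B)`, `μ(O ∩ U) ≥ Σ_B μ(σ_B)·μ_H({x↔B, z↮B} ∩ U)`
(the cluster of `x` in `G` contains its cluster off `o`), while every reference mass factors as `μ(σ_∅) ×` the corresponding plain mass of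
`H`.  For each `B` the required `H`-inequality is EXACTLY prim-hp-7's set-observer marker dominance lemma
(`HullPort.setMarkerDominance_hcov`, the `T_A` induction) with observer set `N = B`; summing it against the weights `μ(σ_B) ≥ 0` gives PCOV.
So PCOV[Q9] = `μ(σ_∅)² · E_Ξ[setMDL(Ξ)]`, `Ξ` the random set of open neighbours of `o` (identity checked exactly, memo §0(8)).
[cite: KozmaNitzan2024, Questions 8–9 (§5.5 p. 36), Lemma 5 and proof of Thm. 4 (pp. 13–14), §5.1 (pp. 31–32)]
[cite: VandenbergHaggstromKahn2005, Thms. 1.3–1.5 (pp. 6–8), §2.1]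
-/

namespace Summit.CriticalPhenomena.PercolationContinuityZ3.Theorems

open MeasureTheory Set Literature.Probability.LatticeModels Literature.Probability.Percolation
open scoped Classical
open KNPreFKG

noncomputable section

namespace PocketCert

variable {V : Type*} [Fintype V]

/-- **PCOV for the Question-9 pocket.**  Owner `x`, marker `y`, weak relay `z`, observer `o` (`x, y, z ≠ o`, `x ≠ y`), `𝒰` an
up-set of vertex sets, `σ_∅ = {no open pair at o}` (`= {C_o = {o}}`), `D = {x↮z}`, `E2 = {y↮x} ∩ {y↮z}`:
`μ(σ_∅ ∩ E2)·[μ(σ_∅ ∩ D)·μ({x↔o} ∩ D ∩ U) − μ({x↔o} ∩ D)·μ(σ_∅ ∩ D ∩ U)]`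
`  − μ({y↔o} ∩ E2)·[μ(σ_∅ ∩ D ∩ {x↮y})·μ(σ_∅ ∩ D ∩ {x↔y} ∩ U) − μ(σ_∅ ∩ D ∩ {x↔y})·μ(σ_∅ ∩ D ∩ {x↮y} ∩ U)] ≥ 0`,
`U = {C_x ∈ 𝒰}` — prim-lf-2's (P1**-D) for the pocket `{C_o = {o}}`.  Star decomposition at `o` + `HullPort.setMarkerDominance_hcov`
in `H = G ∖ o` for every star.
[cite: KozmaNitzan2024, Questions 8–9 (§5.5 p. 36), Lemma 5 (p. 13)] [cite: VandenbergHaggstromKahn2005, Thms. 1.3–1.5 (pp. 6–8)] -/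
theorem pcov_questionNine (w : Sym2 V → unitInterval) (o x y z : V) (hxo : x ≠ o) (hyo : y ≠ o) (hzo : z ≠ o)
    (hxy : x ≠ y) (𝒰 : Set (Set V)) (h𝒰 : IsUpperSet 𝒰) :
    0 ≤ (prodBernoulli w).real (starEvent o (∅ : Set V) ∩
            ({ω : BondConfig V | ¬ (openGraph ω).Reachable y x} ∩ {ω | ¬ (openGraph ω).Reachable y z})) *
          ((prodBernoulli w).real (starEvent o (∅ : Set V) ∩ {ω : BondConfig V | ¬ (openGraph ω).Reachable x z}) *
              (prodBernoulli w).real (openConn x o ∩ {ω : BondConfig V | ¬ (openGraph ω).Reachable x z} ∩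
                {ω | openCluster ω x ∈ 𝒰}) -
            (prodBernoulli w).real (openConn x o ∩ {ω : BondConfig V | ¬ (openGraph ω).Reachable x z}) *
              (prodBernoulli w).real (starEvent o (∅ : Set V) ∩ {ω : BondConfig V | ¬ (openGraph ω).Reachable x z} ∩
                {ω | openCluster ω x ∈ 𝒰})) -
        (prodBernoulli w).real (openConn y o ∩
            ({ω : BondConfig V | ¬ (openGraph ω).Reachable y x} ∩ {ω | ¬ (openGraph ω).Reachable y z})) *
          ((prodBernoulli w).real (starEvent o (∅ : Set V) ∩ {ω : BondConfig V | ¬ (openGraph ω).Reachable x z} ∩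
                {ω | ¬ (openGraph ω).Reachable x y}) *
              (prodBernoulli w).real (starEvent o (∅ : Set V) ∩ {ω : BondConfig V | ¬ (openGraph ω).Reachable x z} ∩
                openConn x y ∩ {ω | openCluster ω x ∈ 𝒰}) -
            (prodBernoulli w).real (starEvent o (∅ : Set V) ∩ {ω : BondConfig V | ¬ (openGraph ω).Reachable x z} ∩
                openConn x y) *
              (prodBernoulli w).real (starEvent o (∅ : Set V) ∩ {ω : BondConfig V | ¬ (openGraph ω).Reachable x z} ∩
                {ω | ¬ (openGraph ω).Reachable x y} ∩ {ω | openCluster ω x ∈ 𝒰})) := by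
  classical
  set μ := prodBernoulli w with hμ
  have hn := fun (S' : Set (BondConfig V)) => (measureReal_nonneg : 0 ≤ μ.real S')
  set S : Set V := ({o}ᶜ : Set V) with hS
  set μH := prodBernoulli (restrW S w) with hμH
  have hnH := fun (S' : Set (BondConfig V)) => (measureReal_nonneg : 0 ≤ μH.real S')
  -- events of `G`
  set D : Set (BondConfig V) := {ω : BondConfig V | ¬ (openGraph ω).Reachable x z} with hD
  set AU : Set (BondConfig V) := {ω : BondConfig V | openCluster ω x ∈ 𝒰} with hAU
  set E2 : Set (BondConfig V) := {ω : BondConfig V | ¬ (openGraph ω).Reachable y x} ∩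
      {ω | ¬ (openGraph ω).Reachable y z} with hE2
  set XY : Set (BondConfig V) := (openConn x y : Set (BondConfig V)) with hXY
  set NXY : Set (BondConfig V) := {ω : BondConfig V | ¬ (openGraph ω).Reachable x y} with hNXY
  set σ0 : Set (BondConfig V) := starEvent o (∅ : Set V) with hσ0
  -- events of `H` (read on the cut configuration `ω ∩ wireSet S`)
  set OB : Finset V → Set (BondConfig V) := fun B =>
      {ω : BondConfig V | ∃ u ∈ B, (openGraph ω).Reachable x u} ∩ {ω | ∀ u ∈ B, ¬ (openGraph ω).Reachable z u} with hOB
  set YB : Finset V → Set (BondConfig V) := fun B =>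
      {ω : BondConfig V | ∃ u ∈ B, (openGraph ω).Reachable y u} ∩
        ({ω | ∀ u ∈ B, ¬ (openGraph ω).Reachable x u} ∩ {ω | ∀ u ∈ B, ¬ (openGraph ω).Reachable z u}) with hYB
  set cut : BondConfig V → BondConfig V := fun ω => ω ∩ wireSet S with hcutdef
  -- generic facts
  have hdet : ∀ E : Set (BondConfig V), DeterminedBy {ω : BondConfig V | cut ω ∈ E} (wireSet S) := by
    intro E
    rw [determinedBy_iff]
    intro ω ω' hωω'
    simp only [hcutdef, mem_setOf_eq]
    rw [hωω']
  have hbr : ∀ E : Set (BondConfig V), μH.real E = μ.real {ω | cut ω ∈ E} := fun E => KNGoodAux.restrW_real_eq w S E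
  have hprod : ∀ (B : Set V) (E : Set (BondConfig V)),
      μ.real (starEvent o B ∩ {ω | cut ω ∈ E}) = μ.real (starEvent o B) * μH.real E := by
    intro B E
    rw [hbr E]
    exact KNGoodAux.real_starEvent_inter_of_determinedBy w o B (hdet E)
  have hxS : x ∈ S := mem_compl_singleton_iff.2 hxo
  have hyS : y ∈ S := mem_compl_singleton_iff.2 hyo
  have hzS : z ∈ S := mem_compl_singleton_iff.2 hzo
  -- reachability of the cut configuration = reachability off `o`
  have hcut : ∀ (ω : BondConfig V) {p : V} (hp : p ∈ S) (q : V),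
      (openGraph (cut ω)).Reachable p q ↔ ω ∈ openConnIn S p q := fun ω p hp q =>
    KNGoodAux.inter_wireSet_mem_openConn_iff hp q
  have hcut_le : ∀ (ω : BondConfig V) (p q : V), (openGraph (cut ω)).Reachable p q → (openGraph ω).Reachable p q :=
    fun ω p q h => h.mono (SimpleGraph.fromEdgeSet_mono inter_subset_left)
  -- under `σ_B`, an open path of `ω` from `p ≠ o` to `q ≠ o` is off `o` or passes through `B` at both ends
  have hdec : ∀ (B : Set V) (ω : BondConfig V), ω ∈ starEvent o B → ∀ {p q : V}, p ∈ S → q ≠ o →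
      (openGraph ω).Reachable p q →
        (openGraph (cut ω)).Reachable p q ∨
          ((∃ u ∈ B, (openGraph (cut ω)).Reachable p u) ∧ ∃ u' ∈ B, (openGraph (cut ω)).Reachable u' q) := by
    intro B ω hσ p q hp hq hpq
    obtain ⟨pth⟩ := hpq
    rcases (KNPreFKG.walk_decomp hσ pth hq).1 (mem_compl_singleton_iff.1 hp) with h | ⟨⟨u, huB, huo, hpu⟩, ⟨u', hu'B, hu'o, hu'q⟩⟩
    · exact Or.inl ((hcut ω hp q).2 h)
    · exact Or.inr ⟨⟨u, huB, (hcut ω hp u).2 hpu⟩, ⟨u', hu'B, (hcut ω (mem_compl_singleton_iff.2 hu'o) q).2 hu'q⟩⟩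
  -- under `σ_B`, a vertex of `B` reached off `o` is reached from `o`
  have hreach : ∀ (B : Set V) (ω : BondConfig V), ω ∈ starEvent o B → o ∉ B → ∀ u ∈ B, ∀ q : V,
      (openGraph (cut ω)).Reachable u q → (openGraph ω).Reachable o q := by
    intro B ω hσ hoB u huB q huq
    have huo : u ≠ o := fun h => hoB (h ▸ huB)
    have hou : s(o, u) ∈ ω := ((mem_starEvent_iff o B ω).1 hσ u huo).2 huB
    have hadj : (openGraph ω).Adj o u := (openGraph_adj ω o u).2 ⟨hou, huo.symm⟩
    exact hadj.reachable.trans (hcut_le ω u q huq)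
  -- (A) under `σ_∅`: reachability from a vertex `≠ o` equals reachability of the cut configuration; clusters agree
  have hA : ∀ (ω : BondConfig V), ω ∈ σ0 → ∀ {p : V}, p ∈ S → ∀ q : V,
      ((openGraph ω).Reachable p q ↔ (openGraph (cut ω)).Reachable p q) := by
    intro ω hσ p hp q
    constructor
    · intro hpq
      by_cases hq : q = o
      · -- `q = o` is isolated in `ω`
        exfalso
        subst hq
        obtain ⟨pth⟩ := hpq
        have key := (KNPreFKG.walk_decomp hσ pth.reverse (mem_compl_singleton_iff.1 hp)).2 rfl
        obtain ⟨u', hu', -, -⟩ := key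
        exact hu'
      · rcases hdec ∅ ω hσ hp hq hpq with h | ⟨⟨u, hu, -⟩, -⟩
        · exact h
        · exact absurd hu (Set.notMem_empty u)
    · exact hcut_le ω p q
  have hAcl : ∀ (ω : BondConfig V), ω ∈ σ0 → openCluster ω x = openCluster (cut ω) x := by
    intro ω hσ
    ext q
    exact hA ω hσ hxS q
  -- (A') the reference masses factor: `μ(σ_∅ ∩ E) = μ(σ_∅) · μ_H(E_H)`
  have fD : σ0 ∩ D = σ0 ∩ {ω | cut ω ∈ D} := by
    ext ω
    simp only [hD, mem_inter_iff, mem_setOf_eq]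
    constructor
    · rintro ⟨hσ, h⟩; exact ⟨hσ, fun h' => h ((hA ω hσ hxS z).2 h')⟩
    · rintro ⟨hσ, h⟩; exact ⟨hσ, fun h' => h ((hA ω hσ hxS z).1 h')⟩
  have fE2 : σ0 ∩ E2 = σ0 ∩ {ω | cut ω ∈ E2} := by
    ext ω
    simp only [hE2, mem_inter_iff, mem_setOf_eq]
    constructor
    · rintro ⟨hσ, h1, h2⟩; exact ⟨hσ, fun h' => h1 ((hA ω hσ hyS x).2 h'), fun h' => h2 ((hA ω hσ hyS z).2 h')⟩
    · rintro ⟨hσ, h1, h2⟩; exact ⟨hσ, fun h' => h1 ((hA ω hσ hyS x).1 h'), fun h' => h2 ((hA ω hσ hyS z).1 h')⟩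
  have fDU : σ0 ∩ D ∩ AU = σ0 ∩ {ω | cut ω ∈ D ∩ AU} := by
    ext ω
    simp only [hD, hAU, mem_inter_iff, mem_setOf_eq]
    constructor
    · rintro ⟨⟨hσ, h⟩, hu⟩
      exact ⟨hσ, fun h' => h ((hA ω hσ hxS z).2 h'), by rwa [← hAcl ω hσ]⟩
    · rintro ⟨hσ, h, hu⟩
      exact ⟨⟨hσ, fun h' => h ((hA ω hσ hxS z).1 h')⟩, by rwa [hAcl ω hσ]⟩
  have fDY : σ0 ∩ D ∩ XY = σ0 ∩ {ω | cut ω ∈ D ∩ XY} := by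
    ext ω
    simp only [hD, hXY, openConn, mem_inter_iff, mem_setOf_eq]
    constructor
    · rintro ⟨⟨hσ, h⟩, hxy'⟩
      exact ⟨hσ, fun h' => h ((hA ω hσ hxS z).2 h'), (hA ω hσ hxS y).1 hxy'⟩
    · rintro ⟨hσ, h, hxy'⟩
      exact ⟨⟨hσ, fun h' => h ((hA ω hσ hxS z).1 h')⟩, (hA ω hσ hxS y).2 hxy'⟩
  have fDN : σ0 ∩ D ∩ NXY = σ0 ∩ {ω | cut ω ∈ D ∩ NXY} := by
    ext ω
    simp only [hD, hNXY, mem_inter_iff, mem_setOf_eq]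
    constructor
    · rintro ⟨⟨hσ, h⟩, hxy'⟩
      exact ⟨hσ, fun h' => h ((hA ω hσ hxS z).2 h'), fun h' => hxy' ((hA ω hσ hxS y).2 h')⟩
    · rintro ⟨hσ, h, hxy'⟩
      exact ⟨⟨hσ, fun h' => h ((hA ω hσ hxS z).1 h')⟩, fun h' => hxy' ((hA ω hσ hxS y).1 h')⟩
  have fDYU : σ0 ∩ D ∩ XY ∩ AU = σ0 ∩ {ω | cut ω ∈ D ∩ XY ∩ AU} := by
    ext ω
    simp only [hD, hXY, hAU, openConn, mem_inter_iff, mem_setOf_eq]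
    constructor
    · rintro ⟨⟨⟨hσ, h⟩, hxy'⟩, hu⟩
      exact ⟨hσ, ⟨fun h' => h ((hA ω hσ hxS z).2 h'), (hA ω hσ hxS y).1 hxy'⟩, by rwa [← hAcl ω hσ]⟩
    · rintro ⟨hσ, ⟨h, hxy'⟩, hu⟩
      exact ⟨⟨⟨hσ, fun h' => h ((hA ω hσ hxS z).1 h')⟩, (hA ω hσ hxS y).2 hxy'⟩, by rwa [hAcl ω hσ]⟩
  have fDNU : σ0 ∩ D ∩ NXY ∩ AU = σ0 ∩ {ω | cut ω ∈ D ∩ NXY ∩ AU} := by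
    ext ω
    simp only [hD, hNXY, hAU, mem_inter_iff, mem_setOf_eq]
    constructor
    · rintro ⟨⟨⟨hσ, h⟩, hxy'⟩, hu⟩
      exact ⟨hσ, ⟨fun h' => h ((hA ω hσ hxS z).2 h'), fun h' => hxy' ((hA ω hσ hxS y).2 h')⟩, by rwa [← hAcl ω hσ]⟩
    · rintro ⟨hσ, ⟨h, hxy'⟩, hu⟩
      exact ⟨⟨⟨hσ, fun h' => h ((hA ω hσ hxS z).1 h')⟩, fun h' => hxy' ((hA ω hσ hxS y).1 h')⟩, by rwa [hAcl ω hσ]⟩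
  -- the `H`-masses
  set s0 : ℝ := μ.real σ0 with hs0
  set cH : ℝ := μH.real E2 with hcH
  set nH : ℝ := μH.real D with hnHdef
  set FH : ℝ := μH.real (D ∩ XY) with hFH
  set EH : ℝ := μH.real (D ∩ NXY) with hEH
  set NU : ℝ := μH.real (D ∩ AU) with hNU
  set N1U : ℝ := μH.real (D ∩ XY ∩ AU) with hN1U
  set N0U : ℝ := μH.real (D ∩ NXY ∩ AU) with hN0U
  have ec : μ.real (σ0 ∩ E2) = s0 * cH := by rw [fE2]; exact hprod ∅ E2
  have en : μ.real (σ0 ∩ D) = s0 * nH := by rw [fD]; exact hprod ∅ D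
  have eNU : μ.real (σ0 ∩ D ∩ AU) = s0 * NU := by rw [fDU]; exact hprod ∅ (D ∩ AU)
  have en1 : μ.real (σ0 ∩ D ∩ XY) = s0 * FH := by rw [fDY]; exact hprod ∅ (D ∩ XY)
  have en0 : μ.real (σ0 ∩ D ∩ NXY) = s0 * EH := by rw [fDN]; exact hprod ∅ (D ∩ NXY)
  have eN1U : μ.real (σ0 ∩ D ∩ XY ∩ AU) = s0 * N1U := by rw [fDYU]; exact hprod ∅ (D ∩ XY ∩ AU)
  have eN0U : μ.real (σ0 ∩ D ∩ NXY ∩ AU) = s0 * N0U := by rw [fDNU]; exact hprod ∅ (D ∩ NXY ∩ AU)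
  -- (B) star identities for the observer-attached masses
  set A : Finset V := Finset.univ.erase o with hA'
  have hoA : o ∉ A := fun h => (Finset.mem_erase.1 h).1 rfl
  have hiso : ∀ u, u ≠ o → u ∉ A → w s(o, u) = 0 :=
    fun u huo hu => absurd (Finset.mem_erase.2 ⟨huo, Finset.mem_univ u⟩) hu
  have hoB : ∀ B ∈ A.powerset, o ∉ (B : Finset V) := fun B hB h => hoA (Finset.mem_powerset.1 hB h)
  -- (B1) `{x↔o} ∩ D ∩ σ_B = σ_B ∩ {cut ∈ OB B}`
  have iO : ∀ B : Finset V, o ∉ B → openConn x o ∩ D ∩ starEvent o ↑B = starEvent o ↑B ∩ {ω | cut ω ∈ OB B} := by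
    intro B hoB'
    ext ω
    simp only [hD, hOB, openConn, mem_inter_iff, mem_setOf_eq]
    constructor
    · rintro ⟨⟨hxo', hxz⟩, hσ⟩
      refine ⟨hσ, ?_, ?_⟩
      · -- the path from `o` to `x` leaves `o` through `B`
        obtain ⟨pth⟩ := (hxo'.symm : (openGraph ω).Reachable o x)
        obtain ⟨u', hu'B, hu'o, hu'x⟩ := (KNPreFKG.walk_decomp hσ pth hxo).2 rfl
        exact ⟨u', hu'B, ((hcut ω hxS u').2
          (by
            have h1 : (openGraph (cut ω)).Reachable u' x := (hcut ω (mem_compl_singleton_iff.2 hu'o) x).2 hu'x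
            exact (hcut ω hxS u').1 h1.symm))⟩
      · intro u huB hzu
        exact hxz (hxo'.trans (hreach (↑B) ω hσ hoB' u huB z hzu.symm))
    · rintro ⟨hσ, ⟨u, huB, hxu⟩, hzB⟩
      refine ⟨⟨(hreach (↑B) ω hσ hoB' u huB x hxu.symm).symm, ?_⟩, hσ⟩
      intro hxz
      rcases hdec (↑B) ω hσ hxS hzo hxz with h | ⟨-, ⟨u', hu'B, hu'z⟩⟩
      · -- `x ↔ z` off `o`: then `z` lies in the cut cluster of `x`, which meets `B`
        exact hzB u huB (h.symm.trans hxu)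
      · exact hzB u' hu'B hu'z.symm
  -- (B2) `{x↔o} ∩ D ∩ U ∩ σ_B ⊇ σ_B ∩ {cut ∈ OB B ∩ U}`
  have iOU : ∀ B : Finset V, o ∉ B → starEvent o ↑B ∩ {ω | cut ω ∈ OB B ∩ AU} ⊆ openConn x o ∩ D ∩ AU ∩ starEvent o ↑B := by
    intro B hoB' ω hω
    obtain ⟨hσ, hOBω, hUω⟩ := hω
    have h1 : ω ∈ openConn x o ∩ D ∩ starEvent o ↑B := by rw [iO B hoB']; exact ⟨hσ, hOBω⟩
    refine ⟨⟨h1.1, ?_⟩, hσ⟩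
    simp only [hAU, mem_setOf_eq] at hUω ⊢
    exact h𝒰 (openCluster_mono inter_subset_left x) hUω
  -- (B3) `{y↔o} ∩ E2 ∩ σ_B = σ_B ∩ {cut ∈ YB B}`
  have iY : ∀ B : Finset V, o ∉ B → openConn y o ∩ E2 ∩ starEvent o ↑B = starEvent o ↑B ∩ {ω | cut ω ∈ YB B} := by
    intro B hoB'
    ext ω
    simp only [hE2, hYB, openConn, mem_inter_iff, mem_setOf_eq]
    constructor
    · rintro ⟨⟨hyo', hyx, hyz⟩, hσ⟩
      refine ⟨hσ, ?_, ?_, ?_⟩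
      · obtain ⟨pth⟩ := (hyo'.symm : (openGraph ω).Reachable o y)
        obtain ⟨u', hu'B, hu'o, hu'y⟩ := (KNPreFKG.walk_decomp hσ pth hyo).2 rfl
        have h1 : (openGraph (cut ω)).Reachable u' y := (hcut ω (mem_compl_singleton_iff.2 hu'o) y).2 hu'y
        exact ⟨u', hu'B, h1.symm⟩
      · intro u huB hxu
        exact hyx (hyo'.trans (hreach (↑B) ω hσ hoB' u huB x hxu.symm))
      · intro u huB hzu
        exact hyz (hyo'.trans (hreach (↑B) ω hσ hoB' u huB z hzu.symm))
    · rintro ⟨hσ, ⟨u, huB, hyu⟩, hxB, hzB⟩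
      refine ⟨⟨(hreach (↑B) ω hσ hoB' u huB y hyu.symm).symm, ?_, ?_⟩, hσ⟩
      · intro hyx
        rcases hdec (↑B) ω hσ hyS hxo hyx with h | ⟨-, ⟨u', hu'B, hu'x⟩⟩
        · exact hxB u huB (h.symm.trans hyu)
        · exact hxB u' hu'B hu'x.symm
      · intro hyz
        rcases hdec (↑B) ω hσ hyS hzo hyz with h | ⟨-, ⟨u', hu'B, hu'z⟩⟩
        · exact hzB u huB (h.symm.trans hyu)
        · exact hzB u' hu'B hu'z.symm
  -- sums over the stars
  have sβ : μ.real (openConn x o ∩ D) = ∑ B ∈ A.powerset, μ.real (starEvent o ↑B) * μH.real (OB B) := by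
    rw [KNPreFKG.real_eq_sum_inter_starEvent w A o hoA hiso (openConn x o ∩ D)]
    refine Finset.sum_congr rfl fun B hB => ?_
    rw [iO B (hoB B hB)]
    exact hprod (↑B) (OB B)
  have sb : μ.real (openConn y o ∩ E2) = ∑ B ∈ A.powerset, μ.real (starEvent o ↑B) * μH.real (YB B) := by
    rw [KNPreFKG.real_eq_sum_inter_starEvent w A o hoA hiso (openConn y o ∩ E2)]
    refine Finset.sum_congr rfl fun B hB => ?_
    rw [iY B (hoB B hB)]
    exact hprod (↑B) (YB B)
  have sO : ∑ B ∈ A.powerset, μ.real (starEvent o ↑B) * μH.real (OB B ∩ AU) ≤ μ.real (openConn x o ∩ D ∩ AU) := by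
    rw [KNPreFKG.real_eq_sum_inter_starEvent w A o hoA hiso (openConn x o ∩ D ∩ AU)]
    refine Finset.sum_le_sum fun B hB => ?_
    rw [← hprod (↑B) (OB B ∩ AU)]
    exact measureReal_mono (iOU B (hoB B hB))
  -- (C) the set-observer marker dominance lemma in `H`, for every star `B`, in event form
  set FU : Set V → ℝ := fun K => if K ∈ 𝒰 then 1 else 0 with hFU
  have hFU_mono : ∀ K K' : Set V, K ⊆ K' → FU K ≤ FU K' := by
    intro K K' hKK'
    simp only [hFU]
    by_cases h : K ∈ 𝒰
    · rw [if_pos h, if_pos (h𝒰 hKK' h)]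
    · rw [if_neg h]; split_ifs <;> norm_num
  have hFU_eq : ∀ ω : BondConfig V, FU (openCluster ω x) = AU.indicator 1 ω := by
    intro ω; simp only [hFU]
    by_cases h : openCluster ω x ∈ 𝒰
    · rw [if_pos h, indicator_of_mem (show ω ∈ AU from h)]; simp
    · rw [if_neg h, indicator_of_notMem (show ω ∉ AU from h)]
  have hcov : ∀ B : Finset V,
      μH.real (YB B) * (nH * N1U - FH * NU) ≤ cH * (nH * μH.real (OB B ∩ AU) - μH.real (OB B) * NU) := by
    intro B
    have key := HullPort.setMarkerDominance_hcov (restrW S w) x y z (↑B : Set V) hxy FU hFU_mono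
    simp_rw [hFU_eq] at key
    rw [setIntegral_indicator_one_eq μH _ AU, setIntegral_indicator_one_eq μH _ AU,
      setIntegral_indicator_one_eq μH _ AU] at key
    -- normalise the event shapes
    have e1 : (openConn x y : Set (BondConfig V)) ∩ {ω : BondConfig V | ¬ (openGraph ω).Reachable x z} ∩ AU = D ∩ XY ∩ AU := by
      ext ω; simp only [hD, hXY, mem_inter_iff]; tauto
    have e2 : (openConn x y : Set (BondConfig V)) ∩ {ω : BondConfig V | ¬ (openGraph ω).Reachable x z} = D ∩ XY := by
      ext ω; simp only [hD, hXY, mem_inter_iff]; tauto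
    have e3 : ({ω : BondConfig V | ∃ n ∈ (↑B : Set V), (openGraph ω).Reachable x n} ∩
        {ω | ∀ n ∈ (↑B : Set V), ¬ (openGraph ω).Reachable z n}) = OB B := by
      ext ω; simp only [hOB, Finset.mem_coe, mem_inter_iff, mem_setOf_eq]
    have e4 : ({ω : BondConfig V | ∃ n ∈ (↑B : Set V), (openGraph ω).Reachable y n} ∩
        ({ω | ∀ n ∈ (↑B : Set V), ¬ (openGraph ω).Reachable x n} ∩ {ω | ∀ n ∈ (↑B : Set V), ¬ (openGraph ω).Reachable z n})) =
        YB B := by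
      ext ω; simp only [hYB, Finset.mem_coe, mem_inter_iff, mem_setOf_eq]
    rw [e1, e2, e3, e4] at key
    -- key : μH(YB)*(nH * N1U - FH * NU) ≤ cH * (nH * μH(OB ∩ AU) - μH(OB) * NU)   (up to the names)
    simpa only [hcH, hnHdef, hFH, hNU, hN1U, hE2, hD] using key
  -- (D) sum the star inequalities against the weights `μ(σ_B) ≥ 0`
  have hsum : (∑ B ∈ A.powerset, μ.real (starEvent o ↑B) * μH.real (YB B)) * (nH * N1U - FH * NU) ≤
      cH * (nH * (∑ B ∈ A.powerset, μ.real (starEvent o ↑B) * μH.real (OB B ∩ AU)) -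
        (∑ B ∈ A.powerset, μ.real (starEvent o ↑B) * μH.real (OB B)) * NU) := by
    have step : ∀ B ∈ A.powerset,
        μ.real (starEvent o ↑B) * μH.real (YB B) * (nH * N1U - FH * NU) ≤
          μ.real (starEvent o ↑B) * (cH * (nH * μH.real (OB B ∩ AU) - μH.real (OB B) * NU)) := by
      intro B hB
      have := mul_le_mul_of_nonneg_left (hcov B) (hn (starEvent o ↑B))
      nlinarith [this]
    have h1 := Finset.sum_le_sum step
    rw [← Finset.sum_mul] at h1
    refine h1.trans (le_of_eq ?_)
    rw [Finset.mul_sum, Finset.sum_mul, ← Finset.sum_sub_distrib, Finset.mul_sum]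
    refine Finset.sum_congr rfl fun B hB => ?_
    ring
  rw [← sb, ← sβ] at hsum
  -- (E) assemble
  rw [ec, en, eNU, en1, en0, eN1U, eN0U]
  have hO := sO
  have hcHn : 0 ≤ cH * nH := mul_nonneg (hnH _) (hnH _)
  have hs0 : 0 ≤ s0 := hn σ0
  have key2 : μ.real (openConn y o ∩ E2) * (nH * N1U - FH * NU) ≤
      cH * (nH * μ.real (openConn x o ∩ D ∩ AU) - μ.real (openConn x o ∩ D) * NU) := by
    have hmono : cH * (nH * (∑ B ∈ A.powerset, μ.real (starEvent o ↑B) * μH.real (OB B ∩ AU)) -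
        μ.real (openConn x o ∩ D) * NU) ≤ cH * (nH * μ.real (openConn x o ∩ D ∩ AU) - μ.real (openConn x o ∩ D) * NU) := by
      nlinarith [mul_le_mul_of_nonneg_left hO hcHn]
    exact hsum.trans hmono
  -- identity `EH * N1U - FH * N0U = nH * N1U - FH * NU` from `D = (D ∩ XY) ⊔ (D ∩ NXY)`
  have hDN : D ∩ NXY = D \ XY := by
    ext ω; simp only [hD, hXY, hNXY, openConn, mem_inter_iff, mem_sdiff, mem_setOf_eq]
  have hDNU : D ∩ NXY ∩ AU = (D ∩ AU) \ XY := by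
    ext ω; simp only [hD, hXY, hNXY, hAU, openConn, mem_inter_iff, mem_sdiff, mem_setOf_eq]; tauto
  have hDYU : D ∩ XY ∩ AU = (D ∩ AU) ∩ XY := by
    ext ω; simp only [mem_inter_iff]; tauto
  have hsplit1 : nH = FH + EH := by
    simp only [hnHdef, hFH, hEH]
    rw [hDN]
    exact (measureReal_inter_add_sdiff (μ := μH) (s := D) (t := XY) MeasurableSet.of_discrete).symm
  have hsplit2 : NU = N1U + N0U := by
    simp only [hNU, hN1U, hN0U]
    rw [hDNU, hDYU]
    exact (measureReal_inter_add_sdiff (μ := μH) (s := D ∩ AU) (t := XY) MeasurableSet.of_discrete).symm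
  have halg : s0 * cH * (s0 * nH * μ.real (openConn x o ∩ D ∩ AU) - μ.real (openConn x o ∩ D) * (s0 * NU)) -
      μ.real (openConn y o ∩ E2) * (s0 * EH * (s0 * N1U) - s0 * FH * (s0 * N0U)) =
      s0 * s0 * (cH * (nH * μ.real (openConn x o ∩ D ∩ AU) - μ.real (openConn x o ∩ D) * NU) -
        μ.real (openConn y o ∩ E2) * (nH * N1U - FH * NU)) := by
    rw [hsplit1, hsplit2]; ring
  rw [halg]
  exact mul_nonneg (mul_nonneg hs0 hs0) (by linarith [key2])

end PocketCert

end

end Summit.CriticalPhenomena.PercolationContinuityZ3.Theorems
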